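/-
Copyright (c) 2026. All rights reserved.
Released under Apache 2.0 license as described in the file LICENSE.
Authors: abc-iut cell, statement-typer seat abc-iut-L4-t3 (wave 1); `⋉`-twin re-elaborated by prover seat abc-iut-L4-t11
(gen 15) per the cell recipe LTIMES-RECIPE (owner abc-iut-L4-t3), statements unchanged.
-/
import Literature.AnabelianGeometry.AbsoluteAnabelian.Ltimes.LogFrobeniusObservables
import Literature.AnabelianGeometry.AbsoluteAnabelian.Ltimes.LogFrobeniusContact
import Literature.AnabelianGeometry.AbsoluteAnabelian.LogFrobeniusIncompatibility
import HarnessLib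

/-!
# [AbsTopIII] Corollary 5.5 (iv), second sentence: `𝔗_{An•}`, `ℋ_{An•}` and the observables `S_log`, `S_log⊞` are not simultaneously compatible

S. Mochizuki, *Topics in absolute anabelian geometry III: global reconstruction algorithms*,
J. Math. Sci. Univ. Tokyo 22 (2015) 939–1156 [MochizukiAbsTopIII2015]; locator read on the page: Cor 5.5 (iv) p. 131
(proof pp. 132–133: "the incompatibility of the introduction of a single model `(Γ⃗^log_v)_□` … that maps isomorphically
… to each copy `(Γ⃗^log_v)_⋎`").

Over `LogFrobeniusObservables.lean` (the observables `S_log⊞`, `S_log` of Cor 5.5 (iii)) and `LogFrobeniusContact.lean` (the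
telecore `𝔗_{An•}` of Cor 5.5 (ii) with its contact structure `ℋ_{An•}` PINNED by generators), this file types the second
sentence of Cor 5.5 (iv): "the telecore structure `𝔗_{An•}` of (ii), the contact structure `ℋ_{An•}` of (ii), and the
observables `S_log`, `S_log⊞` of (iii) are not simultaneously compatible" — Def 3.5 (ii) "compatible": there is NO single
family of homotopies on the telecore diagram `D_{An•}` (which contains `D•_{≤5}`, hence the diagrams of the observables,
`embPlus`/`embTS`) containing the telecore family `𝔍`, the contact structure and (the images of) the families of `S_log⊞` and
`S_log` at every `v` (`Cor55NotSimultaneouslyCompatible`). An ASSUMPTION on `(L, T)` asserted by the text for the genuine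
theaters. Refereed pre-IUT material; nothing here bears on [IUTchIII] Cor. 3.12; typed ≠ discharged.

**`⋉`-TWIN (cell row «LTIMES-SUCCESSOR», L4-lead m162; typing finding T3g9-F1).**  This file is the verbatim
re-elaboration of `LogFrobeniusIncompatibility.lean` over the successor interface `LogFrobeniusSettingLtimes`
(`Ltimes/LogFrobeniusCompatibility.lean`: `ι⊞_{v,ε}` indexed by the edges of `Γ⃗^⋉_v` at EVERY place, [AbsTopIII] Cor 5.5 (iii)
p. 131), produced by the cell recipe `LTIMES-RECIPE.md`: names carry over inside `namespace LogFrobeniusSettingLtimes`, the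
section variable is `Lt`, setting-independent declarations are NOT repeated (the originals are in scope), statements and
proofs are otherwise unchanged.  The original file over the frozen interface stays as it is.
-/

set_option autoImplicit false

universe u

open CategoryTheory Quiver

namespace Literature.AnabelianGeometry.AbsoluteAnabelian

namespace LogFrobeniusSettingLtimes

variable {Vmod : Type u} {isArc : Vmod → Bool} (Lt : LogFrobeniusSettingLtimes Vmod isArc)

-- setting-independent declarations of the original file (namespace `LogFrobeniusSetting`) re-exposed under the
-- successor namespace (recipe rule 5); the originals are imported, not repeated.
export LogFrobeniusSetting (inFive_of_inTwo inFive_of_inPortionThree embPlus embTS SubFamily)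


/-- the family of homotopies of `S_log⊞` at `v` EMBEDS into a family `K` on `D_{An•}`. [cite: MochizukiAbsTopIII2015, Cor 5.5 (iv) p. 131] -/
def CompatibleInTelecorePlus (J : DSub (InFive (isArc := isArc)) → Type u)
    (tel : ∀ {a : DSub (InFive (isArc := isArc))}, J a → (Lt.An ⥤ a.1.categoryLtimes Lt))
    (K : (Lt.anTelecoreDiagram J tel).HomotopyFamily) (v : Vmod) (H : (Lt.logDiagramPlus v).HomotopyFamily) : Prop :=
  ∀ ⦃a b : (logShapePlus (isArc := isArc) v).Vertex⦄ (p q : Path a b) (h : H.E p q),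
    ∃ h' : K.E ((embPlus J v).mapPath p) ((embPlus J v).mapPath q), HEq (H.η h) (K.η h')

/-- the family of homotopies of `S_log` at `v` EMBEDS into a family `K` on `D_{An•}`. [cite: MochizukiAbsTopIII2015, Cor 5.5 (iv) p. 131] -/
def CompatibleInTelecoreTS (J : DSub (InFive (isArc := isArc)) → Type u)
    (tel : ∀ {a : DSub (InFive (isArc := isArc))}, J a → (Lt.An ⥤ a.1.categoryLtimes Lt))
    (K : (Lt.anTelecoreDiagram J tel).HomotopyFamily) (v : Vmod) (H : (Lt.logDiagramTS v).HomotopyFamily) : Prop :=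
  ∀ ⦃a b : (logShapeTS (isArc := isArc) v).Vertex⦄ (p q : Path a b) (h : H.E p q),
    ∃ h' : K.E ((embTS J v).mapPath p) ((embTS J v).mapPath q), HEq (H.η h) (K.η h')

/-- **Cor 5.5 (iv), second sentence** (assumption on `(L, T)`): "the telecore structure `𝔗_{An•}` of (ii), the contact structure
`ℋ_{An•}` of (ii), and the observables `S_log`, `S_log⊞` of (iii) are not simultaneously compatible" — for the telecore with
pinned edges `φ_⋏ = φ_{An•}` (as in `Cor55Telecore`), a contact structure with the pinned generators (`IsAnContactGenerated`)
and observable families at every `v` (`IsLogObservablePlus`, `IsLogObservableTS`), no family of homotopies on `D_{An•}`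
contains `𝔍`, `ℋ_{An•}` and the embedded families of all the `S_log⊞`, `S_log`. QUANTIFICATION DISCLOSURE (audit note
L6-t22 N1): print speaks of THE telecore `𝔗_{An•}` of (ii); no canonical core structure being nameable in the typed
setting, the `¬ ∃` below ranges over EVERY core structure of (i) (`n = 6`, core vertex `An•[𝒳]`) and every telecore over
it with the pinned edges and pinned contact generators — formally STRONGER than print (the printed argument, pp. 132–133,
"a single model `(Γ⃗^log_v)_□` … that maps isomorphically … to each copy `(Γ⃗^log_v)_⋎`", does not use the specific core
homotopies). Degenerate boundary: for `V(F_mod) = ∅` no core structure exists (`LogFrobeniusTelecoreProofs`,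
`not_cor55Telecore_of_isEmpty`), so the statement holds trivially there; its content is at `V(F_mod) ≠ ∅`.
[cite: MochizukiAbsTopIII2015, Cor 5.5 (iv) p. 131] -/
def Cor55NotSimultaneouslyCompatible (TS : Lt.TSHomotopies) : Prop :=
  ¬ ∃ (H : ((Lt.subdiagram (InFive (isArc := isArc))).extend (Lt.obsExt InFive .an)).HomotopyFamily)
      (hH : ∀ ⦃a b : (obsShape (InFive (isArc := isArc)) DVertex.an).Vertex⦄ ⦃p q : Path a b⦄,
        H.E p q → b = (obsShape (InFive (isArc := isArc)) DVertex.an).obs)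
      (hc : (DiagramOfCategories.Observable.mk _ (fun _ => (inferInstance : IsEmpty PEmpty.{u + 1})) _ H hH).IsCore)
      (T : DiagramOfCategories.Telecore _ _ hc)
      (_ : T.J = (fun a => TelecoreIdx a.1))
      (_ : HEq (fun (a : DSub (InFive (isArc := isArc))) (j : T.J a) => T.telMap j)
        (fun (a : DSub (InFive (isArc := isArc))) (j : TelecoreIdx a.1) => Lt.telecoreFun a.1 j))
      (Hc : (Lt.anTelecoreDiagram T.J T.telMap).HomotopyFamily)
      (Hplus : ∀ v : Vmod, (Lt.logDiagramPlus v).HomotopyFamily) (Hts : ∀ v : Vmod, (Lt.logDiagramTS v).HomotopyFamily)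
      (K : (Lt.anTelecoreDiagram T.J T.telMap).HomotopyFamily),
    DiagramOfCategories.Telecore.IsContactStructure _ T Hc ∧ Lt.IsAnContactGenerated T Hc ∧
      (∀ v : Vmod, Lt.IsLogObservablePlus v (Hplus v) ∧ Lt.IsLogObservableTS TS v (Hts v)) ∧
      SubFamily T.Jfam K ∧ SubFamily Hc K ∧
      ∀ v : Vmod, Lt.CompatibleInTelecorePlus T.J T.telMap K v (Hplus v) ∧ Lt.CompatibleInTelecoreTS T.J T.telMap K v (Hts v)

end LogFrobeniusSettingLtimes

end Literature.AnabelianGeometry.AbsoluteAnabelian
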